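import Summits.QuantumFields.YangMills.Theorems.SqueezedSkewnessChiChainFinal
import HarnessLib

/-!
# LINE ν «weak femto currency» — RETYPE skeleton for `FemtoFloorUnit` (stmt-QuantumFields-23545), crux `BalabanLadder.NT` (19353)

Planner ym-idea-6 g13.  HYGIENE ∕ RETYPE LINE — NO new mechanism.  The fleet lead's consumption audit
(`Theorems/SqueezedSkewnessWeakFemtoUnit.lean`, ✓p677057; `…ChiChainFinal.lean` `nt_of_weakFemtoUnit_shellSign`) showed that the
χ-chain consumes of `FC2` only the WEAK floor clause (F) (lower half on x-centred femto cubes in the forward cone + growth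
`Γ(s)/s⁸ → ∞` + collar `s·K(s) → 0`; no upper bound, no continuity, no `Γ ≤ 1`) and left «a candidate RETYPE of 23679; planner's
call».  The call: YES — but NOT by `--restate` of `FemtoTwoPointUnit` (23679), which seven landed Theorems files consume BY NAME and
destructure; instead the weak unit is registered HERE as a by-name engine stub on the PARENT item `FemtoFloorUnit` (23545, whose other
child `CollarBumpFloors` 23680 is proved), next to the existing by-name stub `FemtoTwoPointUnit`.  Either stub closes 23545 through a
LANDED theorem; nothing in the route file changes; no cap is touched.

Registered stubs: `stub_weakFemtoUnit` (crux XL, engine-grade: `∀ G, ∃ (r, a), units ∧ FBL6 ∧ (F)` — verbatim the hypothesis of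
`femtoFloorUnit_of_weak`), `stub_femtoTwoPointUnit` (= item 23679 BY NAME).  Compositions (kernel-checked, no sorry outside stubs):
`FemtoFloorUnit_of : stub_weakFemtoUnit → FemtoFloorUnit` (= `femtoFloorUnit_of_weak`), `FemtoFloorUnit_of_twoPoint :
stub_femtoTwoPointUnit → FemtoFloorUnit` (= `squeezedSkewness_femtoCurrencyGlue_proof · collarBumpFloors_proof`),
`nodeB_of_weak : stub_weakFemtoUnit → PointlikeHypercubeFloorsB` (RP escalator, landed), `NT_of_weak_shellSign : stub_weakFemtoUnit →
ShellSign → BalabanLadder.NT` (= `nt_of_weakFemtoUnit_shellSign`).  No NT / node / summit statement is proved here. [folklore]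
-/

set_option autoImplicit false

namespace Summit.QuantumFields.YangMills.Cruxes.FemtoFloorUnit.WeakCurrencyBirth

open Filter Topology
open Literature.MathematicalPhysics.QuantumFieldTheory Literature.MathematicalPhysics.QuantumLattice
open Summit.QuantumFields.YangMills.Cruxes.OSLegsFromFemtoAndGap.DlrCollarTransfer
open Summit.QuantumFields.YangMills.Theses.SqueezedSkewness

namespace __Registered

/-- registered stub «WeakFemtoUnit» (crux, XL, engine-grade — the clause-(i) engine debt of route SqueezedSkewness net of the landed
consumption audit): for every compact simple `G` a unit `(r, a)`, `0 < a → 0`, carrying the plane-resolved femto boundary law `FBL6`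
and the WEAK two-point floor clause (F).  Why it might fail: Bałaban's exterior-uniform `C/depth⁴` boundary law and an `a`-uniform
separated femto two-point FLOOR for 4-D Yang–Mills in the SAME dynamically pinned unit are not in print (engine table N32′/N25).
[cite: Balaban1985; Balaban1989] -/
abbrev stub_weakFemtoUnit : Prop :=
  ∀ (G : Type) [Group G] [TopologicalSpace G] [IsTopologicalGroup G] [CompactSpace G],
    IsCompactSimpleLieGroup G → letI : MeasurableSpace G := borel G; haveI : BorelSpace G := ⟨rfl⟩;
    ∃ (r : LatticeRep G) (a : ℝ → ℝ), (∀ β, 0 < a β) ∧ Tendsto a atTop (𝓝 0) ∧ FBL6 G r a ∧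
    (∃ (Γ : ℝ → ℝ) (β₂ ℓ₂ c₂ : ℝ) (K : ℝ → ℝ) (n₀ : ℕ), 0 < ℓ₂ ∧ 0 < c₂ ∧ (∀ s, 1 ≤ K s) ∧
    Tendsto (fun s : ℝ => s * K s) (nhdsWithin 0 (Set.Ioi 0)) (nhds 0) ∧ 1 ≤ n₀ ∧
    Tendsto (fun s : ℝ => Γ s / s ^ 8) (nhdsWithin 0 (Set.Ioi 0)) atTop ∧
    ∀ β : ℝ, β₂ ≤ β → ∀ (x : Fin 4 → ℤ) (R : ℕ), ((2 * R + 1 : ℕ) : ℝ) * a β ≤ ℓ₂ →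
      ∀ (η : LGConfig 4 G) (y : Fin 4 → ℤ) (s₀ : ℝ), 0 < s₀ → s₀ ≤ ‖siteToE (y - x)‖ * a β →
        (n₀ : ℝ) ≤ ‖siteToE (y - x)‖ → ‖siteToE (y - x)‖ < 3 * siteToE (y - x) 0 →
          K s₀ * ‖siteToE (y - x)‖ ≤ depth (fun j => x j - R) (2 * R + 1) y →
            c₂ * Γ (‖siteToE (y - x)‖ * a β) ≤
              ‖siteToE (y - x)‖ ^ 8 * kerCov G r β (fun j => x j - R) (2 * R + 1) η (dens G r x) (dens G r y))

/-- = `SqueezedSkewness.FemtoTwoPointUnit` (stmt-QuantumFields-23679: `FBL6 ∧ FC2` in one unit) BY NAME — the heavier, already filed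
form of the same currency. [folklore] -/
abbrev stub_femtoTwoPointUnit : Prop :=
  Summit.QuantumFields.YangMills.Theses.SqueezedSkewness.FemtoTwoPointUnit

end __Registered

/-- stub «WeakFemtoUnit» (crux XL, engine). -/
theorem stub_weakFemtoUnit : __Registered.stub_weakFemtoUnit := by
  sorry

/-- stub (item 23679 by name, crux XL, engine). -/
theorem stub_femtoTwoPointUnit : __Registered.stub_femtoTwoPointUnit := by
  sorry

/-- **Composition (kernel-checked; concludes item 23545's decl BY NAME)**: the weak femto unit gives `FemtoFloorUnit` —
the landed `femtoFloorUnit_of_weak`. [folklore] -/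
theorem FemtoFloorUnit_of (hW : __Registered.stub_weakFemtoUnit) : FemtoFloorUnit :=
  Summit.QuantumFields.YangMills.Theorems.SqueezedSkewnessWeakFemtoUnit.femtoFloorUnit_of_weak hW

/-- The heavier currency also gives `FemtoFloorUnit` (landed femto currency glue + `CollarBumpFloors` ✓). [folklore] -/
theorem FemtoFloorUnit_of_twoPoint (hU : __Registered.stub_femtoTwoPointUnit) : FemtoFloorUnit :=
  Summit.QuantumFields.YangMills.Theorems.squeezedSkewness_femtoCurrencyGlue_proof hU
    Summit.QuantumFields.YangMills.Theorems.CollarBumpFloorsProof.collarBumpFloors_proof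

/-- Node B from the weak unit (RP chessboard escalator, landed). [folklore] -/
theorem nodeB_of_weak (hW : __Registered.stub_weakFemtoUnit) : PointlikeHypercubeFloorsB :=
  Summit.QuantumFields.YangMills.Theorems.SqueezedSkewnessChiChainRP.pointlikeHypercubeFloorsB_of_rpEscalator
    (FemtoFloorUnit_of hW)
    Summit.QuantumFields.YangMills.Theorems.SqueezedSkewnessEscalatorOfLogConvex.stub_rpChordEscalator

/-- `BalabanLadder.NT` from the weak unit and `ShellSign` (27861) — the landed `nt_of_weakFemtoUnit_shellSign`. [folklore] -/
theorem NT_of_weak_shellSign (hW : __Registered.stub_weakFemtoUnit) (hSign : ShellSign) :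
    Summit.QuantumFields.YangMills.Theses.BalabanLadder.NT :=
  Summit.QuantumFields.YangMills.Theorems.SqueezedSkewnessChiChainFinal.nt_of_weakFemtoUnit_shellSign hW hSign

end Summit.QuantumFields.YangMills.Cruxes.FemtoFloorUnit.WeakCurrencyBirth
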